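import Literature.NumberTheory.Congruences.DworkCongruencesGhostTerms
import Literature.Combinatorics.Enumerative.AperyDworkCongruences
import Literature.Combinatorics.Enumerative.AperyLucasCongruences
import Literature.Combinatorics.Enumerative.DombNumbers
import HarnessLib

/-!
# Dwork congruences for sporadic Apéry-like sequences: Franel numbers and `Σ_k C(n,k)² C(2k,k)` (Gorodetsky 2021)

Topic `Literature/Combinatorics/Enumerative`, namespace `Literature.Combinatorics.Enumerative.SporadicDworkCongruences`
(joins `AperyDworkCongruences` / `AperyZetaThreeDworkCongruences`; consumer of
`Literature/NumberTheory/Congruences/DworkCongruences*.lean`).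

Source, read on the page: O. Gorodetsky, *New representations for all sporadic Apéry-like sequences, with
applications to congruences*, Exp. Math. **32** (2023) 641–656 = arXiv:2102.11839 [Gorodetsky2021] (held text
`paper:arxiv-2102.11839`, arXiv numbering):
* §2.1, (D3) and **Theorem 2.3** ([SamolVanstraten2015], [MellitVlasenko2016]): "Let `Λ ∈ ℤ[x_1^{±1},…,x_d^{±1}]` be
  a Laurent polynomial. If the Newton polytope of `Λ` contains the origin as its only interior integral point, then the
  sequence `u_n = CT(Λ^n)` satisfies the D3 congruences" `u_{n+mp^s} u_{⌊n/p⌋} ≡ u_n u_{⌊(n+mp^s)/p⌋} mod p^s` — the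
  tree's `DworkCongruencesGhostTerms.dwork_congruence`;
* **Proposition 3.3** (table): "The constant term series of the Laurent polynomials in the second column are g.f.s of
  the sequences in the first column: **A** `(xy)^{−1}(x+1)(y+1)(x+y)` … **C** `(xy)^{−1}(x+y+1)(xy+x+y)` …", where
  (§1.1, table) **A** = `Σ_k C(n,k)³` (Franel numbers) and **C** = `Σ_k C(n,k)² C(2k,k)`;
* **Theorem 1.1** ("For all but possibly `(η)`, the Laurent polynomials may be chosen in such a way that their Newton
  polytopes contain the origin as their only interior integral point") and **Corollary 2.4**: "All the sporadic
  sequences, except possibly `(η)`, satisfy the D3 congruences."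

What is formalised (everything PROVED, no named facts):

* a reusable Newton-polytope criterion, **`originUnique_of_cube`**: if every exponent of `Λ` lies in the cube
  `[−1,1]^d` and all `±e_i` are exponents, then `OriginUniqueInteriorLatticePoint Λ` (the open cross-polytope
  `Σ|x_i| < 1` lies in the hull of the `±e_i`; an interior lattice point has `|u_i| < 1`); the cube hypothesis is
  supplied by `support_mul_single_negOnes` from `SuppIn (unitCube d) N 2` for `Λ = N · (x_1⋯x_d)^{−1}`, and
  `SuppIn (unitCube d) _ 1` holds for sums of monomials with `0/1` exponents (`suppIn_unitCube_single`) — this is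
  how the paper's "drawing the corresponding Newton polygon" (§3.6) is discharged here;
* **A** (Franel): `franelLaurent`, `ctPow_franelLaurent : [Λ_A^n]_0 = Σ_k C(n,k)³` (= the tree's
  `AperyLucasCongruences.genApery 3 0 n`), `originUnique_franelLaurent`, **`franel_dwork_congruence`**;
* **C**: `momentLaurent`, `ctPow_momentLaurent : [Λ_C^n]_0 = Σ_k C(n,k)² C(2k,k)` (= the tree's
  `threeStepMoment n`, the moments `W_3(2n)`), `originUnique_momentLaurent`, **`threeStepMoment_dwork_congruence`**.

The constant-term identities are proved by coefficient extraction in `ℤ[x][y]` (the paper proves Prop. 3.3 by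
comparing annihilating differential operators — creative telescoping; we deviate and compute directly:
`[y^n]` then `[x^n]`, using `C(n,a)C(n,n−a)` bookkeeping and, for **C**, the reflection `a ↦ n−a`).

Nearest existing declarations (used, not restated): `AperyDworkCongruences.{expVec, X1, X2, toLaurent, coeff_toLaurent,
q, q_coeff, q_sq_coeff, latticeEmb_apply}`, `AperyLucasCongruences.genApery`, `Enumerative.threeStepMoment`
(`DombNumbers`), `DworkCongruencesGhostTerms.{dwork_congruence, SuppIn, suppIn_one}`.  Related: the Lucas congruences
(the case `s = 1`) for these sequences are `DombLucasCongruences.threeStepMoment_modEq_mul` and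
`AperyLucasCongruences.genApery_modEq_mul`; the other sporadic sequences of [Gorodetsky2021, Prop. 3.3] are not treated
here.
-/

noncomputable section

open Finset Polynomial Pointwise

namespace Literature.Combinatorics.Enumerative.SporadicDworkCongruences

open Literature.NumberTheory.Congruences.DworkCongruences
open Literature.Combinatorics.Enumerative.AperyDworkCongruences (expVec expVec_zero expVec_one expVec_add nsmul_expVec
  X1 X2 coeff_toLaurent q q_coeff q_sq_coeff latticeEmb_apply)
open Literature.Combinatorics.Enumerative.AperyLucasCongruences (genApery)

/-! ## A Newton-polytope criterion: exponents in the cube `[−1,1]^d`, all `±e_i` present -/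

section Cube

variable {d : ℕ}

/-- The unit cube `[0,1]^d ⊂ ℝ^d`. [cite: Gorodetsky2021, §3.6 (proof of Thm. 1.1: checking the Newton polytopes)] -/
def unitCube (d : ℕ) : Set (Fin d → ℝ) := Set.pi Set.univ fun _ => Set.Icc (0 : ℝ) 1

/-- The unit cube is convex. [cite: Gorodetsky2021, §3.6] -/
theorem convex_unitCube : Convex ℝ (unitCube d) := convex_pi fun _ _ => convex_Icc 0 1

/-- `0 ∈ [0,1]^d`. [cite: Gorodetsky2021, §3.6] -/
theorem zero_mem_unitCube : (0 : Fin d → ℝ) ∈ unitCube d := by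
  rw [unitCube, Set.mem_univ_pi]
  exact fun _ => ⟨le_rfl, zero_le_one⟩

/-- Membership in the dilate `a · [0,1]^d` (`a > 0`). [cite: Gorodetsky2021, §3.6] -/
theorem mem_smul_unitCube_iff {a : ℝ} (ha : 0 < a) {x : Fin d → ℝ} :
    x ∈ a • unitCube d ↔ ∀ i, 0 ≤ x i ∧ x i ≤ a := by
  rw [Set.mem_smul_set]
  constructor
  · rintro ⟨y, hy, rfl⟩ i
    rw [unitCube, Set.mem_univ_pi] at hy
    obtain ⟨h0, h1⟩ := hy i
    simp only [Pi.smul_apply, smul_eq_mul]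
    exact ⟨mul_nonneg ha.le h0, by nlinarith⟩
  · intro h
    refine ⟨a⁻¹ • x, ?_, smul_inv_smul₀ ha.ne' x⟩
    rw [unitCube, Set.mem_univ_pi]
    intro i
    obtain ⟨h0, h1⟩ := h i
    simp only [Pi.smul_apply, smul_eq_mul, Set.mem_Icc]
    exact ⟨mul_nonneg (inv_nonneg.2 ha.le) h0, by rw [inv_mul_le_iff₀ ha]; linarith⟩

/-- A monomial with `0/1` exponents has support in `[0,1]^d`. [cite: Gorodetsky2021, §3.6] -/
theorem suppIn_unitCube_single {v : Fin d → ℤ} (hv : ∀ i, v i = 0 ∨ v i = 1) (r : ℤ) :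
    SuppIn (unitCube d) (AddMonoidAlgebra.single v r : LaurentPoly ℤ d) 1 := by
  intro u hu
  rw [AddMonoidAlgebra.coeff_single] at hu
  have := Finsupp.support_single_subset hu
  rw [Finset.mem_singleton] at this
  rw [this, mem_smul_unitCube_iff one_pos]
  intro i
  rcases hv i with h | h <;> simp [h]

/-- `supp 1 ⊂ [0,1]^d`. [cite: Gorodetsky2021, §3.6] -/
theorem suppIn_unitCube_one : SuppIn (unitCube d) (1 : LaurentPoly ℤ d) 1 :=
  suppIn_one zero_mem_unitCube 1

/-- The exponent `(−1, …, −1)` of the common denominator `x_1 ⋯ x_d`. [cite: Gorodetsky2021, Prop. 3.3] -/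
def negOnes (d : ℕ) : Fin d → ℤ := fun _ => -1

/-- If the numerator `N` has exponents in `2 · [0,1]^d`, then `Λ = N/(x_1⋯x_d)` has exponents in `[−1,1]^d`.
[cite: Gorodetsky2021, §3.6] -/
theorem support_mul_single_negOnes {N : LaurentPoly ℤ d} (hN : SuppIn (unitCube d) N 2) {v : Fin d → ℤ}
    (hv : v ∈ (N * AddMonoidAlgebra.single (negOnes d) 1).coeff.support) (i : Fin d) : -1 ≤ v i ∧ v i ≤ 1 := by
  rw [Finsupp.mem_support_iff, AddMonoidAlgebra.coeff_mul_single_apply, mul_one] at hv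
  have h := (mem_smul_unitCube_iff two_pos).1 (hN _ (Finsupp.mem_support_iff.2 hv)) i
  simp only [latticeEmb_apply, Pi.add_apply, Pi.neg_apply, negOnes] at h
  push_cast at h
  obtain ⟨h1, h2⟩ := h
  have e1 : (-1 : ℝ) ≤ v i := by linarith
  have e2 : (v i : ℝ) ≤ 1 := by linarith
  exact ⟨by exact_mod_cast e1, by exact_mod_cast e2⟩

/-- **Cube criterion.** If every exponent of `Λ` lies in `[−1,1]^d` (`d ≥ 1`) and all `±e_i` are exponents of `Λ`,
then the Newton polytope of `Λ` has the origin as its only interior lattice point: the open cross-polytope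
`Σ_i |x_i| < 1` lies in the hull of the `±e_i`, and a lattice point interior to a subset of the cube has `|u_i| < 1`.
[cite: Gorodetsky2021, §3.6 (proof of Thm. 1.1)] -/
theorem originUnique_of_cube (Λ : LaurentPoly ℤ d) (hd : 0 < d)
    (hcube : ∀ v ∈ Λ.coeff.support, ∀ i, -1 ≤ v i ∧ v i ≤ 1)
    (hplus : ∀ i, Pi.single i 1 ∈ Λ.coeff.support) (hminus : ∀ i, Pi.single i (-1) ∈ Λ.coeff.support) :
    OriginUniqueInteriorLatticePoint Λ := by
  have hS : ∀ v ∈ Λ.coeff.support, latticeEmb d v ∈ newtonPolytope Λ :=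
    fun v hv => subset_convexHull ℝ _ ⟨v, hv, rfl⟩
  constructor
  · -- the open cross-polytope lies in the polytope
    have hcross : {x : Fin d → ℝ | ∑ i, |x i| < 1} ⊆ newtonPolytope Λ := by
      intro x hx
      rw [Set.mem_setOf_eq] at hx
      set r := 1 - ∑ i, |x i| with hr
      have hr0 : 0 < r := by linarith
      have hdR : (0 : ℝ) < d := by exact_mod_cast hd
      let w : Fin d ⊕ Fin d → ℝ :=
        Sum.elim (fun i => max (x i) 0 + r / (2 * d)) (fun i => max (-x i) 0 + r / (2 * d))
      let z : Fin d ⊕ Fin d → (Fin d → ℝ) :=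
        Sum.elim (fun i => latticeEmb d (Pi.single i 1)) (fun i => latticeEmb d (Pi.single i (-1)))
      have hw0 : ∀ i ∈ (Finset.univ : Finset (Fin d ⊕ Fin d)), 0 ≤ w i := by
        rintro (i | i) -
        · exact add_nonneg (le_max_right _ _) (div_nonneg hr0.le (by positivity))
        · exact add_nonneg (le_max_right _ _) (div_nonneg hr0.le (by positivity))
      have hw1 : ∑ i, w i = 1 := by
        rw [Fintype.sum_sum_type]
        simp only [w, Sum.elim_inl, Sum.elim_inr, Finset.sum_add_distrib, Finset.sum_const, Finset.card_univ,
          Fintype.card_fin, nsmul_eq_mul]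
        have hm : ∑ i, max (x i) 0 + ∑ i, max (-x i) 0 = ∑ i, |x i| := by
          rw [← Finset.sum_add_distrib]
          exact Finset.sum_congr rfl fun i _ => max_zero_add_max_neg_zero_eq_abs_self (x i)
        have h2 : (d : ℝ) * (r / (2 * d)) = r / 2 := by
          field_simp
        rw [h2]
        linarith
      have hz : ∀ i ∈ (Finset.univ : Finset (Fin d ⊕ Fin d)), z i ∈ newtonPolytope Λ := by
        rintro (i | i) -
        · exact hS _ (hplus i)
        · exact hS _ (hminus i)
      have hsum : ∑ i, w i • z i = x := by
        ext j
        rw [Finset.sum_apply, Fintype.sum_sum_type]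
        simp only [w, z, Sum.elim_inl, Sum.elim_inr, Pi.smul_apply, smul_eq_mul, latticeEmb_apply,
          Pi.single_apply, Int.cast_ite, Int.cast_one, Int.cast_neg, Int.cast_zero, mul_ite, mul_one, mul_neg,
          mul_zero, Finset.sum_ite_eq, Finset.mem_univ, if_true]
        linarith [max_zero_sub_max_neg_zero_eq_self (x j)]
      have := (convex_convexHull ℝ _).sum_mem hw0 hw1 hz
      rwa [hsum] at this
    have hopen : IsOpen {x : Fin d → ℝ | ∑ i, |x i| < 1} :=
      isOpen_lt (continuous_finsetSum _ fun i _ => (continuous_apply i).abs) continuous_const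
    apply interior_mono hcross
    rw [hopen.interior_eq]
    simp
  · -- an interior lattice point has all coordinates in `(−1, 1)`
    intro u hu
    rw [mem_interior_iff_mem_nhds, Metric.mem_nhds_iff] at hu
    obtain ⟨ε, hε, hball⟩ := hu
    have hP : newtonPolytope Λ ⊆ Set.pi Set.univ (fun _ : Fin d => Set.Icc (-1 : ℝ) 1) := by
      refine convexHull_min ?_ (convex_pi fun _ _ => convex_Icc (-1 : ℝ) 1)
      rintro _ ⟨v, hv, rfl⟩
      rw [Set.mem_univ_pi]
      intro i
      rw [Set.mem_Icc, latticeEmb_apply]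
      obtain ⟨h1, h2⟩ := hcube v hv i
      exact ⟨by exact_mod_cast h1, by exact_mod_cast h2⟩
    have hpt : ∀ (i : Fin d) (δ : ℝ), |δ| < ε → latticeEmb d u + Pi.single i δ ∈ Metric.ball (latticeEmb d u) ε := by
      intro i δ hδ
      rw [Metric.mem_ball, dist_eq_norm, add_sub_cancel_left, Pi.norm_single, Real.norm_eq_abs]
      exact hδ
    have hε2 : |ε / 2| < ε := by rw [abs_of_pos (by positivity)]; linarith
    have hε2' : |-(ε / 2)| < ε := by rw [abs_neg]; exact hε2
    ext i
    have h1 := hP (hball (hpt i (ε / 2) hε2))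
    have h2 := hP (hball (hpt i (-(ε / 2)) hε2'))
    rw [Set.mem_univ_pi] at h1 h2
    have h1i := (h1 i).2
    have h2i := (h2 i).1
    simp only [Pi.add_apply, latticeEmb_apply, Pi.single_eq_same] at h1i h2i
    have hu1 : (u i : ℝ) < 1 := by linarith
    have hu2 : (-1 : ℝ) < u i := by linarith
    have i1 : u i < 1 := by exact_mod_cast hu1
    have i2 : (-1 : ℤ) < u i := by exact_mod_cast hu2
    show u i = 0
    omega

end Cube

/-! ## Two variables: monomials with `0/1` exponents -/

/-- `supp x_1 ⊂ [0,1]²`. [cite: Gorodetsky2021, Prop. 3.3] -/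
theorem suppIn_X1 : SuppIn (unitCube 2) X1 1 :=
  suppIn_unitCube_single (Fin.forall_fin_two.2 ⟨Or.inr rfl, Or.inl rfl⟩) 1

/-- `supp x_2 ⊂ [0,1]²`. [cite: Gorodetsky2021, Prop. 3.3] -/
theorem suppIn_X2 : SuppIn (unitCube 2) X2 1 :=
  suppIn_unitCube_single (Fin.forall_fin_two.2 ⟨Or.inl rfl, Or.inr rfl⟩) 1

/-- `x_1 x_2` is the monomial with exponent `(1,1)`. [cite: Gorodetsky2021, Prop. 3.3] -/
theorem X1_mul_X2 : X1 * X2 = AddMonoidAlgebra.single (expVec 1 1) 1 := by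
  rw [X1, X2, AddMonoidAlgebra.single_mul_single, expVec_add, mul_one]
  norm_num

/-- `supp x_1x_2 ⊂ [0,1]²`. [cite: Gorodetsky2021, Prop. 3.3] -/
theorem suppIn_X1X2 : SuppIn (unitCube 2) (X1 * X2) 1 := by
  rw [X1_mul_X2]
  exact suppIn_unitCube_single (Fin.forall_fin_two.2 ⟨Or.inr rfl, Or.inr rfl⟩) 1

/-- `−(n • (−1,−1)) = (n, n)`. [cite: Gorodetsky2021, Prop. 3.3] -/
theorem neg_nsmul_negOnes_two (n : ℕ) : -(n • negOnes 2) = expVec (n : ℤ) (n : ℤ) := by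
  ext k; fin_cases k <;> simp [negOnes]

/-- `Pi.single 0 c = (c, 0)` and `Pi.single 1 c = (0, c)` in `ℤ²`. [cite: Gorodetsky2021, Prop. 3.3] -/
theorem single_eq_expVec (c : ℤ) : (Pi.single 0 c : Fin 2 → ℤ) = expVec c 0 ∧ (Pi.single 1 c : Fin 2 → ℤ) = expVec 0 c := by
  constructor <;> (ext k; fin_cases k <;> simp)

/-! ## **A**: the Franel numbers `Σ_k C(n,k)³ = CT[((x+1)(y+1)(x+y)/(xy))^n]` -/

/-- The Franel numerator `(1+x)(1+y)(x+y)`, as a polynomial in `y` over `ℤ[x]`: `C(1+x) · (y + 1)(y + x)`.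
[cite: Gorodetsky2021, Prop. 3.3 (row **A**)] -/
def franelNumer : ℤ[X][X] := C q * ((X + C 1) * (X + C X))

/-- Gorodetsky's Laurent polynomial for **A**: `Λ_A = (x+1)(y+1)(x+y)/(xy)`. [cite: Gorodetsky2021, Prop. 3.3 (row **A**)] -/
def franelLaurent : LaurentPoly ℤ 2 := AperyDworkCongruences.toLaurent franelNumer * AddMonoidAlgebra.single (negOnes 2) 1

/-- `[y^n] numer^n = (1+x)^n Σ_a C(n,a)² x^a`. [cite: Gorodetsky2021, Prop. 3.3 (row **A**)] -/
theorem coeff_franelNumer_pow (n : ℕ) :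
    (franelNumer ^ n).coeff n = q ^ n * ∑ a ∈ range (n + 1), ((n.choose a : ℤ[X]) * (n.choose a : ℤ[X])) * X ^ a := by
  rw [franelNumer, mul_pow, ← map_pow, coeff_C_mul, mul_pow, coeff_mul, Finset.Nat.sum_antidiagonal_eq_sum_range_succ_mk]
  congr 1
  refine Finset.sum_congr rfl fun a ha => ?_
  rw [Finset.mem_range, Nat.lt_succ_iff] at ha
  simp only
  rw [coeff_X_add_C_pow, coeff_X_add_C_pow, one_pow, one_mul, Nat.sub_sub_self ha, Nat.choose_symm ha]
  ring

/-- `[x^n y^n] numer^n = Σ_a C(n,a)³` (the Franel number, the tree's `genApery 3 0 n`).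
[cite: Gorodetsky2021, Prop. 3.3 (row **A**), §1.1 (table: **A** `u_n = Σ_k C(n,k)³`)] -/
theorem coeff_coeff_franelNumer_pow (n : ℕ) : ((franelNumer ^ n).coeff n).coeff n = (genApery 3 0 n : ℤ) := by
  rw [coeff_franelNumer_pow, Finset.mul_sum, finsetSum_coeff, genApery, Nat.cast_sum]
  refine Finset.sum_congr rfl fun a ha => ?_
  have ha' : a ≤ n := by rw [Finset.mem_range] at ha; omega
  rw [← C_eq_natCast, ← map_mul, mul_left_comm, coeff_C_mul, coeff_mul_X_pow', if_pos ha', q, coeff_one_add_X_pow,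
    Nat.choose_symm ha', pow_zero, mul_one]
  push_cast
  ring

/-- **`CT[Λ_A^n] = Σ_k C(n,k)³`.** [cite: Gorodetsky2021, Prop. 3.3 (row **A**)] -/
theorem ctPow_franelLaurent (n : ℕ) : ctPow franelLaurent n = (genApery 3 0 n : ℤ) := by
  unfold ctPow constTerm franelLaurent
  rw [mul_pow, ← map_pow, AddMonoidAlgebra.single_pow, one_pow, AddMonoidAlgebra.coeff_mul_single_apply, mul_one,
    zero_add, neg_nsmul_negOnes_two, coeff_toLaurent, coeff_coeff_franelNumer_pow]

/-- `Λ_A · xy = (1 + x + y + xy)(x + y)` inside the Laurent ring. [cite: Gorodetsky2021, Prop. 3.3 (row **A**)] -/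
theorem toLaurent_franelNumer : AperyDworkCongruences.toLaurent franelNumer = (1 + X1 + X2 + X1 * X2) * (X1 + X2) := by
  simp only [AperyDworkCongruences.toLaurent, franelNumer, q, Polynomial.coe_eval₂RingHom, eval₂_mul, eval₂_add, eval₂_C, eval₂_X,
    eval₂_one]
  ring

/-- The numerator's exponents lie in `2 · [0,1]²`. [cite: Gorodetsky2021, §3.6] -/
theorem suppIn_franelNumer : SuppIn (unitCube 2) (AperyDworkCongruences.toLaurent franelNumer) 2 := by
  have hA : SuppIn (unitCube 2) (1 + X1 + X2 + X1 * X2) 1 :=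
    ((suppIn_unitCube_one.add suppIn_X1).add suppIn_X2).add suppIn_X1X2
  have hB : SuppIn (unitCube 2) (X1 + X2) 1 := suppIn_X1.add suppIn_X2
  rw [toLaurent_franelNumer, show (2 : ℝ) = 1 + 1 by norm_num]
  exact hA.mul convex_unitCube hB zero_le_one zero_le_one

/-- `numer = C(1+x) y² + C((1+x)²) y + C(x(1+x))`. [cite: Gorodetsky2021, Prop. 3.3 (row **A**)] -/
theorem franelNumer_eq : franelNumer = C q * X ^ 2 + C (q ^ 2) * X + C (q * X) := by
  simp only [franelNumer, q, map_add, map_mul, map_pow, map_one]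
  ring

/-- `[y²] numer = 1 + x`. [cite: Gorodetsky2021, Prop. 3.3 (row **A**)] -/
theorem franelNumer_coeff_two : franelNumer.coeff 2 = q := by
  rw [franelNumer_eq]
  simp only [coeff_add, coeff_C_mul_X_pow, coeff_C_mul_X, coeff_C]
  simp

/-- `[y] numer = (1 + x)²`. [cite: Gorodetsky2021, Prop. 3.3 (row **A**)] -/
theorem franelNumer_coeff_one : franelNumer.coeff 1 = q ^ 2 := by
  rw [franelNumer_eq]
  simp only [coeff_add, coeff_C_mul_X_pow, coeff_C_mul_X, coeff_C]
  simp

/-- `[y⁰] numer = x(1 + x)`. [cite: Gorodetsky2021, Prop. 3.3 (row **A**)] -/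
theorem franelNumer_coeff_zero : franelNumer.coeff 0 = q * X := by
  rw [franelNumer_eq]
  simp only [coeff_add, coeff_C_mul_X_pow, coeff_C_mul_X, coeff_C]
  simp

/-- Coefficients of `Λ_A` in terms of the numerator. [cite: Gorodetsky2021, Prop. 3.3 (row **A**)] -/
theorem coeff_franelLaurent (a b : ℤ) (i j : ℕ) (ha : a + 1 = i) (hb : b + 1 = j) :
    franelLaurent.coeff (expVec a b) = (franelNumer.coeff j).coeff i := by
  rw [franelLaurent, AddMonoidAlgebra.coeff_mul_single_apply, mul_one,
    show expVec a b + -negOnes 2 = expVec (i : ℤ) (j : ℤ) by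
      rw [← ha, ← hb]; ext l; fin_cases l <;> simp [negOnes],
    coeff_toLaurent]

/-- The exponents `±e_1, ±e_2` occur in `Λ_A` (all with coefficient `1`). [cite: Gorodetsky2021, §3.6] -/
theorem unit_mem_support_franel :
    (∀ i : Fin 2, Pi.single i (1 : ℤ) ∈ franelLaurent.coeff.support) ∧
      ∀ i : Fin 2, Pi.single i (-1 : ℤ) ∈ franelLaurent.coeff.support := by
  simp only [Fin.forall_fin_two, (single_eq_expVec 1).1, (single_eq_expVec 1).2, (single_eq_expVec (-1)).1,
    (single_eq_expVec (-1)).2, Finsupp.mem_support_iff]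
  refine ⟨⟨?_, ?_⟩, ?_, ?_⟩
  · rw [coeff_franelLaurent 1 0 2 1 (by norm_num) (by norm_num), franelNumer_coeff_one, q_sq_coeff]; simp
  · rw [coeff_franelLaurent 0 1 1 2 (by norm_num) (by norm_num), franelNumer_coeff_two, q_coeff]; simp
  · rw [coeff_franelLaurent (-1) 0 0 1 (by norm_num) (by norm_num), franelNumer_coeff_one, q_sq_coeff]; simp
  · rw [coeff_franelLaurent 0 (-1) 1 0 (by norm_num) (by norm_num), franelNumer_coeff_zero, coeff_mul_X, q_coeff]
    simp

/-- The Newton polygon of `Λ_A` (the hexagon with vertices `±e_1, ±e_2, ±(e_1 − e_2)`) has the origin as its only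
interior lattice point. [cite: Gorodetsky2021, Thm. 1.1 / §3.6 (row **A**)] -/
theorem originUnique_franelLaurent : OriginUniqueInteriorLatticePoint franelLaurent :=
  originUnique_of_cube franelLaurent two_pos
    (fun _ hv => by rw [franelLaurent] at hv; exact support_mul_single_negOnes suppIn_franelNumer hv)
    unit_mem_support_franel.1 unit_mem_support_franel.2

/-- **Dwork (D3) congruences for the Franel numbers** `f_n = Σ_k C(n,k)³`: for every prime `p`, `s ≥ 1`, `m, n ≥ 0`,
`p^s ∣ f_{n+mp^s} f_{⌊n/p⌋} − f_n f_{⌊n/p⌋+mp^{s−1}}`. [cite: Gorodetsky2021, Cor. 2.4 (with Prop. 3.3 row **A**,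
Thm. 2.3)] -/
theorem franel_dwork_congruence {p : ℕ} (hp : p.Prime) {s : ℕ} (hs : 1 ≤ s) (m n : ℕ) :
    (p : ℤ) ^ s ∣ (genApery 3 0 (n + m * p ^ s) : ℤ) * genApery 3 0 (n / p) -
      (genApery 3 0 n : ℤ) * genApery 3 0 (n / p + m * p ^ (s - 1)) := by
  have hR : ∀ a : ℤ, (p : ℤ) ∣ a ^ p - a := fun a => by
    haveI := Fact.mk hp
    rw [← ZMod.intCast_zmod_eq_zero_iff_dvd]
    push_cast
    rw [ZMod.pow_card, sub_self]
  have h := dwork_congruence hp hR franelLaurent originUnique_franelLaurent hs n m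
  simpa only [ctPow_franelLaurent] using h

/-! ## **C**: `Σ_k C(n,k)² C(2k,k) = CT[((x+y+1)(xy+x+y)/(xy))^n]` -/

/-- The numerator `(x+y+1)(xy+x+y)`, as a polynomial in `y` over `ℤ[x]`: `(y + (1+x)) · ((1+x) y + x)`.
[cite: Gorodetsky2021, Prop. 3.3 (row **C**)] -/
def momentNumer : ℤ[X][X] := (X + C q) * (C q * X + C X)

/-- Gorodetsky's Laurent polynomial for **C**: `Λ_C = (x+y+1)(xy+x+y)/(xy)`. [cite: Gorodetsky2021, Prop. 3.3 (row **C**)] -/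
def momentLaurent : LaurentPoly ℤ 2 := AperyDworkCongruences.toLaurent momentNumer * AddMonoidAlgebra.single (negOnes 2) 1

/-- `[y^b] ((1+x) y + x)^n = (1+x)^b x^{n−b} C(n,b)` (`b ≤ n`). [cite: Gorodetsky2021, Prop. 3.3 (row **C**)] -/
theorem coeff_linear_pow {n b : ℕ} (hb : b ≤ n) :
    ((C q * X + C (X : ℤ[X])) ^ n).coeff b = q ^ b * X ^ (n - b) * (n.choose b : ℤ[X]) := by
  have term_eq : ∀ m : ℕ, (C q * X) ^ m * (C (X : ℤ[X])) ^ (n - m) * (n.choose m : ℤ[X][X]) =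
      C (q ^ m * X ^ (n - m) * (n.choose m : ℤ[X])) * X ^ m := fun m => by
    simp only [mul_pow, map_mul, map_pow, map_natCast]
    ring
  rw [add_pow, finsetSum_coeff]
  simp_rw [term_eq, coeff_C_mul_X_pow]
  rw [Finset.sum_ite_eq, if_pos (Finset.mem_range.2 (Nat.lt_succ_of_le hb))]

/-- `[y^n] numer^n = Σ_a C(n,a)² (1+x)^{2(n−a)} x^a`. [cite: Gorodetsky2021, Prop. 3.3 (row **C**)] -/
theorem coeff_momentNumer_pow (n : ℕ) : (momentNumer ^ n).coeff n =
    ∑ a ∈ range (n + 1), ((n.choose a : ℤ[X]) * (n.choose a : ℤ[X])) * (q ^ (2 * (n - a)) * X ^ a) := by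
  rw [momentNumer, mul_pow, coeff_mul, Finset.Nat.sum_antidiagonal_eq_sum_range_succ_mk]
  refine Finset.sum_congr rfl fun a ha => ?_
  rw [Finset.mem_range, Nat.lt_succ_iff] at ha
  simp only
  rw [coeff_X_add_C_pow, coeff_linear_pow (Nat.sub_le n a), Nat.sub_sub_self ha, Nat.choose_symm ha]
  ring

/-- `[x^n y^n] numer^n = Σ_k C(n,k)² C(2k,k)` (the tree's `threeStepMoment n`).
[cite: Gorodetsky2021, Prop. 3.3 (row **C**), §1.1 (table: **C** `u_n = Σ_k C(n,k)² C(2k,k)`)] -/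
theorem coeff_coeff_momentNumer_pow (n : ℕ) : ((momentNumer ^ n).coeff n).coeff n = (threeStepMoment n : ℤ) := by
  rw [coeff_momentNumer_pow, finsetSum_coeff, threeStepMoment, ← Finset.sum_range_reflect _ (n + 1), Nat.cast_sum]
  refine Finset.sum_congr rfl fun a ha => ?_
  have ha' : a ≤ n := by rw [Finset.mem_range] at ha; omega
  rw [← C_eq_natCast, ← map_mul, coeff_C_mul, coeff_mul_X_pow', Nat.add_sub_cancel, if_pos (Nat.sub_le n a),
    Nat.sub_sub_self ha', Nat.choose_symm ha', q, coeff_one_add_X_pow]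
  push_cast
  ring

/-- **`CT[Λ_C^n] = Σ_k C(n,k)² C(2k,k)`.** [cite: Gorodetsky2021, Prop. 3.3 (row **C**)] -/
theorem ctPow_momentLaurent (n : ℕ) : ctPow momentLaurent n = (threeStepMoment n : ℤ) := by
  unfold ctPow constTerm momentLaurent
  rw [mul_pow, ← map_pow, AddMonoidAlgebra.single_pow, one_pow, AddMonoidAlgebra.coeff_mul_single_apply, mul_one,
    zero_add, neg_nsmul_negOnes_two, coeff_toLaurent, coeff_coeff_momentNumer_pow]

/-- `Λ_C · xy = (1 + x + y)(x + y + xy)` inside the Laurent ring. [cite: Gorodetsky2021, Prop. 3.3 (row **C**)] -/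
theorem toLaurent_momentNumer : AperyDworkCongruences.toLaurent momentNumer = (1 + X1 + X2) * (X1 + X2 + X1 * X2) := by
  simp only [AperyDworkCongruences.toLaurent, momentNumer, q, Polynomial.coe_eval₂RingHom, eval₂_mul, eval₂_add, eval₂_C, eval₂_X,
    eval₂_one]
  ring

/-- The numerator's exponents lie in `2 · [0,1]²`. [cite: Gorodetsky2021, §3.6] -/
theorem suppIn_momentNumer : SuppIn (unitCube 2) (AperyDworkCongruences.toLaurent momentNumer) 2 := by
  have hA : SuppIn (unitCube 2) (1 + X1 + X2) 1 := (suppIn_unitCube_one.add suppIn_X1).add suppIn_X2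
  have hB : SuppIn (unitCube 2) (X1 + X2 + X1 * X2) 1 := (suppIn_X1.add suppIn_X2).add suppIn_X1X2
  rw [toLaurent_momentNumer, show (2 : ℝ) = 1 + 1 by norm_num]
  exact hA.mul convex_unitCube hB zero_le_one zero_le_one

/-- `numer = C(1+x) y² + C((1+x)² + x) y + C(x(1+x))`. [cite: Gorodetsky2021, Prop. 3.3 (row **C**)] -/
theorem momentNumer_eq : momentNumer = C q * X ^ 2 + C (q ^ 2 + X) * X + C (q * X) := by
  simp only [momentNumer, map_add, map_mul, map_pow]
  ring

/-- `[y²] numer = 1 + x`. [cite: Gorodetsky2021, Prop. 3.3 (row **C**)] -/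
theorem momentNumer_coeff_two : momentNumer.coeff 2 = q := by
  rw [momentNumer_eq]
  simp only [coeff_add, coeff_C_mul_X_pow, coeff_C_mul_X, coeff_C]
  simp

/-- `[y] numer = (1+x)² + x`. [cite: Gorodetsky2021, Prop. 3.3 (row **C**)] -/
theorem momentNumer_coeff_one : momentNumer.coeff 1 = q ^ 2 + X := by
  rw [momentNumer_eq]
  simp only [coeff_add, coeff_C_mul_X_pow, coeff_C_mul_X, coeff_C]
  simp

/-- `[y⁰] numer = x(1+x)`. [cite: Gorodetsky2021, Prop. 3.3 (row **C**)] -/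
theorem momentNumer_coeff_zero : momentNumer.coeff 0 = q * X := by
  rw [momentNumer_eq]
  simp only [coeff_add, coeff_C_mul_X_pow, coeff_C_mul_X, coeff_C]
  simp

/-- Coefficients of `Λ_C` in terms of the numerator. [cite: Gorodetsky2021, Prop. 3.3 (row **C**)] -/
theorem coeff_momentLaurent (a b : ℤ) (i j : ℕ) (ha : a + 1 = i) (hb : b + 1 = j) :
    momentLaurent.coeff (expVec a b) = (momentNumer.coeff j).coeff i := by
  rw [momentLaurent, AddMonoidAlgebra.coeff_mul_single_apply, mul_one,
    show expVec a b + -negOnes 2 = expVec (i : ℤ) (j : ℤ) by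
      rw [← ha, ← hb]; ext l; fin_cases l <;> simp [negOnes],
    coeff_toLaurent]

/-- The exponents `±e_1, ±e_2` occur in `Λ_C` (all with coefficient `1`). [cite: Gorodetsky2021, §3.6] -/
theorem unit_mem_support_moment :
    (∀ i : Fin 2, Pi.single i (1 : ℤ) ∈ momentLaurent.coeff.support) ∧
      ∀ i : Fin 2, Pi.single i (-1 : ℤ) ∈ momentLaurent.coeff.support := by
  simp only [Fin.forall_fin_two, (single_eq_expVec 1).1, (single_eq_expVec 1).2, (single_eq_expVec (-1)).1,
    (single_eq_expVec (-1)).2, Finsupp.mem_support_iff]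
  refine ⟨⟨?_, ?_⟩, ?_, ?_⟩
  · rw [coeff_momentLaurent 1 0 2 1 (by norm_num) (by norm_num), momentNumer_coeff_one, coeff_add, q_sq_coeff,
      coeff_X]
    simp
  · rw [coeff_momentLaurent 0 1 1 2 (by norm_num) (by norm_num), momentNumer_coeff_two, q_coeff]; simp
  · rw [coeff_momentLaurent (-1) 0 0 1 (by norm_num) (by norm_num), momentNumer_coeff_one, coeff_add, q_sq_coeff,
      coeff_X_zero]
    simp
  · rw [coeff_momentLaurent 0 (-1) 1 0 (by norm_num) (by norm_num), momentNumer_coeff_zero, coeff_mul_X, q_coeff]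
    simp

/-- The Newton polygon of `Λ_C` has the origin as its only interior lattice point.
[cite: Gorodetsky2021, Thm. 1.1 / §3.6 (row **C**)] -/
theorem originUnique_momentLaurent : OriginUniqueInteriorLatticePoint momentLaurent :=
  originUnique_of_cube momentLaurent two_pos
    (fun _ hv => by rw [momentLaurent] at hv; exact support_mul_single_negOnes suppIn_momentNumer hv)
    unit_mem_support_moment.1 unit_mem_support_moment.2

/-- **Dwork (D3) congruences for `W_n = Σ_k C(n,k)² C(2k,k)`** (the tree's `threeStepMoment`): for every prime `p`,
`s ≥ 1`, `m, n ≥ 0`, `p^s ∣ W_{n+mp^s} W_{⌊n/p⌋} − W_n W_{⌊n/p⌋+mp^{s−1}}`.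
[cite: Gorodetsky2021, Cor. 2.4 (with Prop. 3.3 row **C**, Thm. 2.3)] -/
theorem threeStepMoment_dwork_congruence {p : ℕ} (hp : p.Prime) {s : ℕ} (hs : 1 ≤ s) (m n : ℕ) :
    (p : ℤ) ^ s ∣ (threeStepMoment (n + m * p ^ s) : ℤ) * threeStepMoment (n / p) -
      (threeStepMoment n : ℤ) * threeStepMoment (n / p + m * p ^ (s - 1)) := by
  have hR : ∀ a : ℤ, (p : ℤ) ∣ a ^ p - a := fun a => by
    haveI := Fact.mk hp
    rw [← ZMod.intCast_zmod_eq_zero_iff_dvd]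
    push_cast
    rw [ZMod.pow_card, sub_self]
  have h := dwork_congruence hp hR momentLaurent originUnique_momentLaurent hs n m
  simpa only [ctPow_momentLaurent] using h

end Literature.Combinatorics.Enumerative.SporadicDworkCongruences
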